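import Summits.BirchSwinnertonDyer.BirchSwinnertonDyer.Theorems.Rank2ObservatoryAnomHeightFreeBounds
import Summits.BirchSwinnertonDyer.BirchSwinnertonDyer.Theorems.Rank2ObservatoryPadicAtlasKitR3
import Summits.BirchSwinnertonDyer.BirchSwinnertonDyer.Theorems.Rank2ObservatoryPadicAtlasR2A00
import Literature.NumberTheory.EllipticCurves.AnomalousOfRationalTorsionProofs
import HarnessLib

/-!
# BirchSwinnertonDyer — rank ≥ 2 observatory: HEIGHT-FREE `Ш[p^∞] = 0` and `ord_p Reg_p = r` at a
# UNIT CELL of the `p`-adic atlas (anom seat, gen 7, join J9; part 2 of 2)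

HONEST FRAMING: per-curve certified theorems and census instruments; no claim on BSD in rank ≥ 2.

Cell `b2b-bsdr2` (run/shared/lean/b2b/bsd-rank2-observatory/), ANOM seat. ONE new per-cell instrument,
NO data: at a good ordinary prime `p ≥ 5` of a rank-`r` curve `E/ℚ` whose kernel-checked symbol
certificate (`Rank2ObservatoryPadicAtlas*.lean`, cells `(p, a_p, n, A, tabHi, tabLo, H, L)`) has
`p ∤ A·H − L` — the leading coefficient `[T^r] L_p(E,T)` is a `p`-adic UNIT, not merely nonzero — and
`p ∤ a_p − 1` (non-anomalous), the printed inequality of Kato (Thm. 17.4) + Perrin-Riou–Schneider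
(BMS 2016 Thm. 1.7), tree theorem `padicBSD_inequality_of_kato_of_surjective_pow`,
`ord_p #Ш[p^∞] + ord_p((1 − α⁻¹)² · ∏c_ℓ · Reg_p) ≤ ord_p([T^r]L_p · log_p(γ)^r · #E(ℚ)_tors²) = r`,
is SATURATED by the elementary bound `‖Reg_p‖ ≤ p^(-r)` of part 1
(`Rank2ObservatoryAnomHeightFreeBounds.lean`: canonical heights of `p`-primitively admissible multiples
lie in `pℤ_p`; ultrametric Hadamard), whence `#Ш(E/ℚ)[p^∞] = 1` and `ord_p Reg_p(E) = r` EXACTLY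
(`sha_card_eq_one_of_unit_leadingCoeff`; at `p ≥ 5` a canonical height datum exists,
`exists_isCanonical_holds`, so the `Ш` statement carries none: `sha_card_eq_one_heightFree`) — with NO
`p`-adic height, NO regulator and NO Mordell–Weil generator computed. In print (Stein–Wuthrich 2013,
Alg. 11.1 step (2), Prop. 11.2, §12 (2)) the rank `≥ 2` bound on `#Ш[p^∞]` is obtained by COMPUTING
`Reg_p` from generators; the mechanism itself (`λ^an = r`, `μ^an = 0` ⇒ `Ш[p^∞] = 0`, regulator
unit-normalised) is classical (Perrin-Riou 1984, Schneider 1985; Greenberg LNM 1716 pp. 158–9). The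
prediction `ord_p Reg^(MST) = 0` is CHECKED against both height-computing engines in the seat's join J9.

## Hypotheses of the per-cell theorem and how the census discharges them

Named facts (hypotheses, nothing asserted): `hS : Schneider1985_order_charGenerator_odd` (BMS 2016
Thm. 1.7), `hkato` (Kato 2004 Thm. 17.4 for every cyclotomic datum). Per curve: the newform `hf`, the
rank lower bound `hlow` and the symbol DATA `hint`/`htab` exactly as in the atlas series; `Surj W p`
(census `galrep` column + the seat's own Serre-criterion witnesses; `ρ_(E,p^∞)` then surjective by the
tree THEOREM `serre_hasSurjectiveModNGaloisRep_pow_holds`, `p ≥ 5`); `p ∤ ∏c_ℓ` (census, two engines);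
`p`-PRIMITIVE ADMISSIBLE MULTIPLES `hadm` (one `m`, `p ∤ m`, with `m • P` admissible for every
non-torsion `P`; `m = #Ẽ(𝔽_p) · ∏ c_ℓ` works by Silverman AEC VII.2.1 / VII.6.1 and is prime to `p` iff
the cell is non-anomalous with `p ∤ ∏c_ℓ` — a per-curve input recorded in the join table, NOT derived
here). Kernel-decided per cell (`AtlasCell.unitCheck`, `decide`): `p ∤ A·H − L` and `p ∤ a_p − 1`;
`p ∤ #E(ℚ)_tors` is then a THEOREM (`not_dvd_torsionOrder_of_not_dvd_frobeniusTrace_sub_one`).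

Contents: §4 `sha_card_eq_one_of_unit_leadingCoeff` (odd `p`, any canonical `Dh`),
`sha_card_eq_one_heightFree` (`p ≥ 5`, `Surj W p`, no height datum); §5 `AtlasCell.unitCheck`,
`AtlasCurve.heightFreeRow`, `AtlasCurve3.heightFreeRow` (rank 2 / rank 3 kits); §6 exemplar `389a1`.

Per curve; NOT a class theorem; no census verdict is changed by this file.
## References

* K. Kato, Astérisque 295 (2004), Thm. 17.4. [Kato2004Asterisque] · J. Balakrishnan, J. S. Müller,
  W. Stein, Math. Comp. 85 (2016), Thm. 1.7. [BalakrishnanMullerStein2015] · W. Stein, C. Wuthrich,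
  Math. Comp. 82 (2013), §4.1, Alg. 11.1, Prop. 11.2, §12, Thm. 12.3. [SteinWuthrich2013]
* P. Schneider, Invent. Math. 79 (1985); B. Perrin-Riou, Mém. SMF 17 (1984). [Schneider1985] ·
  J.-P. Serre (1968), IV §3.4. [SerreAbelianLadic1968] · J. H. Silverman, AEC (2009), VII.2.1, VII.6.1.
-/

set_option autoImplicit false

-- single-conjunct summit: `Summit.BirchSwinnertonDyer.BirchSwinnertonDyer.…` repeats the name by design
set_option linter.dupNamespace false

noncomputable section

open scoped Classical MatrixGroups ModularForm

open CongruenceSubgroup WeierstrassCurve Literature.NumberTheory.EllipticCurves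
  Literature.NumberTheory.EllipticCurves.ModularForms
  Literature.NumberTheory.EllipticCurves.Rank1Residual
  Literature.NumberTheory.EllipticCurves.Rank1Residual.Typed
  Literature.NumberTheory.EllipticCurves.Wuthrich2014
  Summit.BirchSwinnertonDyer.Rank1Residual.X2

namespace Summit.BirchSwinnertonDyer.BirchSwinnertonDyer.Rank2Observatory

/-! ## §4. `Ш[p^∞] = 0` and `ord_p Reg_p = r` at a unit cell -/

section Main

/-- **Unit cell ⇒ `#Ш(E/ℚ)[p^∞] = 1` and `ord_p Reg_p(E) = rank E(ℚ)` — height-free.** `W` globally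
minimal, `p` odd good ordinary (`hgood`, `hordp`), `ρ_{E,p^n}` surjective for all `n` (`hsurj`), `f` a
newform of `E` (`hf`), `Dh` THE canonical `p`-adic height (`hDh`), named facts `hS`
(Perrin-Riou–Schneider, BMS Thm. 1.7) and `hK` (Kato Thm. 17.4); computed: `ord_{T=0} L_p = r` (`hord`)
and `‖[T^r] L_p‖ = 1` (`hcoeff`, §3); census: `p ∤ a_p − 1` (`hna`), `p ∤ ∏c_ℓ` (`htam`), `p`-primitive
admissible multiples (`hm`, `hadm`). PROOF: Kato–PR–Schneider give `ord_p #Ш[p^∞] + ord_p Reg_p ≤ r`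
(`(1 − α⁻¹)² = (u·#Ẽ(𝔽_p))²`, `∏c_ℓ`, `#E(ℚ)_tors` are units — the last by
`not_dvd_torsionOrder_of_not_dvd_frobeniusTrace_sub_one` —, `ord_p log_p γ = 1`), and `ord_p Reg_p ≥ r`
(`norm_padicRegulator_le`). [cite: Kato2004Asterisque, Thm. 17.4 (3) (p. 273)]
[cite: BalakrishnanMullerStein2015, Thm. 1.7] [cite: SteinWuthrich2013, §§3–4 and Alg. 11.1]
[cite: SilvermanAEC2009, VII.3.1(b)] -/
theorem sha_card_eq_one_of_unit_leadingCoeff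
    (hS : Schneider1985_order_charGenerator_odd)
    (W : WeierstrassCurve ℚ) [W.IsElliptic] [W.IsGloballyMinimal] (p : ℕ) [Fact p.Prime]
    {N : ℕ} [NeZero N] (f : CuspForm (Gamma0 N) 2)
    (hK : ∀ (κ : ZpExtension ℚ p) (γ : Field.absoluteGaloisGroup ℚ),
      kato_divisibility W p (κ := κ) (γ := γ) (f := f))
    (hp : p ≠ 2) (hgood : W.HasGoodReductionAtPrime p) (hordp : ¬ (p : ℤ) ∣ W.frobeniusTrace p)
    (hsurj : ∀ n : ℕ, W.HasSurjectiveModNGaloisRep (p ^ n : ℕ)) (hf : IsNewformOf W f)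
    (Dh : PAdicHeightData W p) (hDh : Dh.IsCanonical)
    (hord : (padicLFunction f (unitRoot W p : ℚ_[p])).order = W.mordellWeilRank)
    (hcoeff : ‖PowerSeries.coeff W.mordellWeilRank (padicLFunction f (unitRoot W p : ℚ_[p]))‖ = 1)
    (hna : ¬ (p : ℤ) ∣ W.frobeniusTrace p - 1) (htam : ¬ p ∣ W.tamagawaProduct)
    {m : ℕ} (hm : ¬ p ∣ m)
    (hadm : ∀ P : W.toAffine.Point, ¬ IsOfFinAddOrder P → W.IsAdmissible p (m • P)) :
    Nat.card (AddCommGroup.primaryComponent W.sha p) = 1 ∧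
      (padicRegulator Dh).valuation = W.mordellWeilRank ∧
      ‖padicRegulator Dh‖ = ((p : ℝ)⁻¹) ^ W.mordellWeilRank := by
  have hpP : p.Prime := Fact.out
  have hp1 : (1 : ℝ) < p := by exact_mod_cast hpP.one_lt
  have hp3 : 3 ≤ p := by have := hpP.two_le; omega
  have hordin : IsOrdinaryAt W p := ⟨hgood, hordp⟩
  obtain ⟨hfin, hR, hle⟩ :=
    padicBSD_inequality_of_kato_of_surjective_pow hS W p f hK hp hgood hordp hsurj hf Dh hDh hord
  haveI := hfin
  set r := W.mordellWeilRank with hr_def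
  set S := AddCommGroup.primaryComponent W.sha p with hS_def
  set R := padicRegulator Dh with hR_def
  have hR0 : R ≠ 0 := hR
  -- the unit factors
  have hNp : ¬ p ∣ W.reductionPointCount p := fun h =>
    hna ((dvd_reductionPointCount_iff_dvd_frobeniusTrace_sub_one W p).mp h)
  have hε : ‖(1 - (unitRoot W p : ℚ_[p])⁻¹) ^ 2‖ = 1 := by
    obtain ⟨u₂, hu₂⟩ := exists_unit_one_sub_unitRoot_inv p W hordin
    have hu1 : ‖((u₂ : ℤ_[p]) : ℚ_[p])‖ = 1 := PadicInt.isUnit_iff.mp u₂.isUnit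
    rw [hu₂, norm_pow, norm_mul, hu1, norm_natCast_eq_one_of_not_dvd hNp, one_mul, one_pow]
  have hc : ‖(W.tamagawaProduct : ℚ_[p])‖ = 1 := norm_natCast_eq_one_of_not_dvd htam
  have htors : ‖(W.torsionOrder : ℚ_[p])‖ = 1 :=
    norm_natCast_eq_one_of_not_dvd
      (not_dvd_torsionOrder_of_not_dvd_frobeniusTrace_sub_one W p hp3 hgood hna)
  obtain ⟨hlog0, hlogv⟩ := valuation_padicLog_cyclotomicGenerator (p := p) hp
  have hlog : ‖padicLog p (cyclotomicGenerator p : ℚ_[p])‖ = (p : ℝ)⁻¹ := by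
    rw [Padic.norm_eq_zpow_neg_valuation hlog0, hlogv, zpow_neg, zpow_one]
  -- the right-hand side has norm `p^{-r}`, valuation `r`
  have hRHS : ‖PowerSeries.coeff r (padicLFunction f (unitRoot W p : ℚ_[p])) *
      (padicLog p (cyclotomicGenerator p) ^ r * (W.torsionOrder : ℚ_[p]) ^ 2)‖ = ((p : ℝ)⁻¹) ^ r := by
    rw [norm_mul, norm_mul, norm_pow, norm_pow, hcoeff, hlog, htors, one_pow, mul_one, one_mul]
  have hRHS0 : PowerSeries.coeff r (padicLFunction f (unitRoot W p : ℚ_[p])) *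
      (padicLog p (cyclotomicGenerator p) ^ r * (W.torsionOrder : ℚ_[p]) ^ 2) ≠ 0 := fun h => by
    rw [h, norm_zero] at hRHS
    exact (pow_pos (inv_pos.mpr (zero_lt_one.trans hp1)) r).ne hRHS
  have hvRHS : (PowerSeries.coeff r (padicLFunction f (unitRoot W p : ℚ_[p])) *
      (padicLog p (cyclotomicGenerator p) ^ r * (W.torsionOrder : ℚ_[p]) ^ 2)).valuation = r :=
    valuation_eq_of_norm_eq hRHS0 (by rw [hRHS, inv_natCast_pow_eq_zpow_neg])
  -- the left-hand side has the norm of `Reg_p`, which is `≤ p^{-r}`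
  have hLHS : ‖(1 - (unitRoot W p : ℚ_[p])⁻¹) ^ 2 * (W.tamagawaProduct : ℚ_[p]) * R‖ = ‖R‖ := by
    rw [norm_mul, norm_mul, hε, hc, one_mul, one_mul]
  have hLHS0 : (1 - (unitRoot W p : ℚ_[p])⁻¹) ^ 2 * (W.tamagawaProduct : ℚ_[p]) * R ≠ 0 := fun h => by
    rw [h, norm_zero] at hLHS
    exact norm_ne_zero_iff.mpr hR0 hLHS.symm
  have hvLHS : ((1 - (unitRoot W p : ℚ_[p])⁻¹) ^ 2 * (W.tamagawaProduct : ℚ_[p]) * R).valuation =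
      R.valuation :=
    valuation_eq_of_norm_eq hLHS0 (by rw [hLHS, Padic.norm_eq_zpow_neg_valuation hR0])
  have hvR : (r : ℤ) ≤ R.valuation :=
    le_valuation_of_norm_le_zpow hR0
      (by rw [← inv_natCast_pow_eq_zpow_neg]; exact norm_padicRegulator_le hp hDh hm hadm)
  rw [hvLHS, hvRHS] at hle
  -- squeeze
  have hv0 : padicValNat p (Nat.card S) = 0 := by omega
  have hvReq : R.valuation = r := by omega
  have hndvd : ¬ p ∣ Nat.card S := by
    rcases padicValNat.eq_zero_iff.mp hv0 with h1 | h0' | hnd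
    · exact absurd h1 hpP.one_lt.ne'
    · exact absurd h0' Nat.card_pos.ne'
    · exact hnd
  refine ⟨natCard_primaryComponent_eq_one p hndvd, hvReq, ?_⟩
  rw [Padic.norm_eq_zpow_neg_valuation hR0, hvReq, inv_natCast_pow_eq_zpow_neg]

/-- **HEIGHT-FREE form at `p ≥ 5` with the census hypothesis `Surj W p`.** No height datum in the
statement: `ρ_{E,p^∞}` is surjective by Serre (tree theorem `serre_hasSurjectiveModNGaloisRep_pow_holds`),
THE canonical height exists (`exists_isCanonical_holds`), and the conclusion is `#Ш(E/ℚ)[p^∞] = 1`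
together with `ord_p Reg_p(E, Dh) = r` for EVERY canonical datum `Dh`. Per curve; NOT a class theorem.
[cite: Kato2004Asterisque, Thm. 17.4 (3) (p. 273)] [cite: BalakrishnanMullerStein2015, Thm. 1.7]
[cite: SerreAbelianLadic1968, Ch. IV §3.4] [cite: SteinWuthrich2013, §4.1 and Alg. 11.1] -/
theorem sha_card_eq_one_heightFree
    (hS : Schneider1985_order_charGenerator_odd)
    (W : WeierstrassCurve ℚ) [W.IsElliptic] [W.IsGloballyMinimal] (p : ℕ) [Fact p.Prime]
    {N : ℕ} [NeZero N] (f : CuspForm (Gamma0 N) 2)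
    (hK : ∀ (κ : ZpExtension ℚ p) (γ : Field.absoluteGaloisGroup ℚ),
      kato_divisibility W p (κ := κ) (γ := γ) (f := f))
    (h5 : 5 ≤ p) (hgood : W.HasGoodReductionAtPrime p) (hordp : ¬ (p : ℤ) ∣ W.frobeniusTrace p)
    (hsurj : Surj W p) (hf : IsNewformOf W f)
    (hord : (padicLFunction f (unitRoot W p : ℚ_[p])).order = W.mordellWeilRank)
    (hcoeff : ‖PowerSeries.coeff W.mordellWeilRank (padicLFunction f (unitRoot W p : ℚ_[p]))‖ = 1)
    (hna : ¬ (p : ℤ) ∣ W.frobeniusTrace p - 1) (htam : ¬ p ∣ W.tamagawaProduct)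
    {m : ℕ} (hm : ¬ p ∣ m)
    (hadm : ∀ P : W.toAffine.Point, ¬ IsOfFinAddOrder P → W.IsAdmissible p (m • P)) :
    Nat.card (AddCommGroup.primaryComponent W.sha p) = 1 ∧
      ∀ Dh : PAdicHeightData W p, Dh.IsCanonical →
        (padicRegulator Dh).valuation = W.mordellWeilRank ∧
          ‖padicRegulator Dh‖ = ((p : ℝ)⁻¹) ^ W.mordellWeilRank := by
  have hp : p ≠ 2 := by omega
  have hsurjpow : ∀ n : ℕ, W.HasSurjectiveModNGaloisRep (p ^ n : ℕ) :=
    serre_hasSurjectiveModNGaloisRep_pow_holds W p h5 hsurj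
  obtain ⟨Dh₀, hDh₀⟩ := exists_isCanonical_holds W p h5 hgood hordp
  refine ⟨(sha_card_eq_one_of_unit_leadingCoeff hS W p f hK hp hgood hordp hsurjpow hf Dh₀ hDh₀ hord
    hcoeff hna htam hm hadm).1, fun Dh hDh => ?_⟩
  exact (sha_card_eq_one_of_unit_leadingCoeff hS W p f hK hp hgood hordp hsurjpow hf Dh hDh hord
    hcoeff hna htam hm hadm).2

end Main

/-! ## §5. The height-free row of a unit cell of the kernel-checked atlas -/

namespace AtlasCell

/-- **The kernel UNIT test of a cell**: `p ∤ A·H − L` (the leading coefficient `[T²] L_p` is a `p`-adic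
unit) and `p ∤ a_p − 1` (the prime is non-anomalous: `p ∤ #Ẽ(𝔽_p)`). [cite: MazurTateTeitelbaum1986Invent, §I.10–I.13] -/
def unitCheck (c : AtlasCell) : Bool :=
  decide (¬ ((c.p : ℤ) ∣ c.A * c.H - c.L)) && decide (¬ ((c.p : ℤ) ∣ c.ap - 1))

variable {c : AtlasCell} (hu : c.unitCheck = true)
include hu

/-- A cell passing the unit test has a unit `SymbolCertL`. [folklore] -/
theorem unitL_of_unitCheck [Fact c.p.Prime] : c.certL.unitL c.p = true := by
  have h := hu
  simp only [unitCheck, Bool.and_eq_true, decide_eq_true_eq] at h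
  exact decide_eq_true h.1

/-- A cell passing the unit test has a unit rank-3 `SymbolCertL` (same `A`, `H`, `L`). [folklore] -/
theorem unitL3_of_unitCheck [Fact c.p.Prime] : c.certL3.unitL c.p = true := by
  have h := hu
  simp only [unitCheck, Bool.and_eq_true, decide_eq_true_eq] at h
  exact decide_eq_true h.1

/-- A cell passing the unit test is non-anomalous: `p ∤ a_p − 1`. [folklore] -/
theorem not_dvd_ap_sub_one_of_unitCheck : ¬ ((c.p : ℤ) ∣ c.ap - 1) := by
  have h := hu
  simp only [unitCheck, Bool.and_eq_true, decide_eq_true_eq] at h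
  exact h.2

end AtlasCell

/-- **The HEIGHT-FREE row of a unit cell of the atlas.** For a curve `C` of the kernel-checked atlas
(`C.check`), a cell `c ∈ C.cells` passing `unitCheck` (`p ∤ A·H − L`, `p ∤ a_p − 1`; `decide`), GIVEN the
named facts `hS` (Perrin-Riou–Schneider at odd `p`, BMS Thm. 1.7) and `hkato` (Kato Thm. 17.4), the
newform `hf`, the census rank certificate `hlow`, the symbol DATA `hint`/`htab` (as in the atlas series),
the census `Surj` at `p` (`hsurj`), `p ∤ ∏c_ℓ` (`htam`) and `p`-primitive admissible multiples (`hm`,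
`hadm`): `rank E(ℚ) = 2`, `#Ш(E/ℚ)[p^∞] = 1`, and `ord_p Reg_p(E, Dh) = 2` for every canonical `Dh` —
no height, regulator or generator computed. Per cell; NOT a class theorem.
[cite: Kato2004Asterisque, Thm. 17.4 (3) (p. 273)] [cite: BalakrishnanMullerStein2015, Thm. 1.7]
[cite: MazurTateTeitelbaum1986Invent, §I.10–I.13] [cite: SteinWuthrich2013, §4.1 and Alg. 11.1] -/
theorem AtlasCurve.heightFreeRow {C : AtlasCurve} (h : C.check = true) {c : AtlasCell} (hc : c ∈ C.cells)
    (hu : c.unitCheck = true) [Fact c.p.Prime]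
    [(C.e.baseChange ℚ).IsElliptic] [(C.e.baseChange ℚ).IsGloballyMinimal]
    (hS : Schneider1985_order_charGenerator_odd) {N : ℕ} [NeZero N] {f : CuspForm (Gamma0 N) 2}
    (hf : IsNewformOf (C.e.baseChange ℚ) f)
    (hkato : ∀ (κ : ZpExtension ℚ c.p) (γ : Field.absoluteGaloisGroup ℚ),
      kato_divisibility (C.e.baseChange ℚ) c.p (κ := κ) (γ := γ) (f := f))
    (hlow : 2 ≤ C.row.curve.mordellWeilRank) (D : ℚ) (hD : ‖(D : ℚ_[c.p])‖ = 1)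
    (hint : ∀ x : ℚ, ‖(ratPlusSymbol f x : ℚ_[c.p])‖ ≤ 1)
    (htab : ∀ u : ℕ, u < c.p ^ (c.n + 1) → ¬ c.p ∣ u →
      ratPlusSymbol f ((u : ℚ) / (c.p : ℚ) ^ (c.n + 1)) = (c.tabHi.getD u 0 : ℚ) / D ∧
      ratPlusSymbol f ((u : ℚ) / (c.p : ℚ) ^ c.n) = (c.tabLo.getD (u % c.p ^ c.n) 0 : ℚ) / D)
    (hsurj : Surj (C.e.baseChange ℚ) c.p) (htam : ¬ c.p ∣ (C.e.baseChange ℚ).tamagawaProduct)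
    {m : ℕ} (hm : ¬ c.p ∣ m)
    (hadm : ∀ P : (C.e.baseChange ℚ).toAffine.Point, ¬ IsOfFinAddOrder P →
      (C.e.baseChange ℚ).IsAdmissible c.p (m • P)) :
    C.row.curve.mordellWeilRank = 2 ∧
      Nat.card (AddCommGroup.primaryComponent (C.e.baseChange ℚ).sha c.p) = 1 ∧
      ∀ Dh : PAdicHeightData (C.e.baseChange ℚ) c.p, Dh.IsCanonical →
        (padicRegulator Dh).valuation = 2 ∧ ‖padicRegulator Dh‖ = ((c.p : ℝ)⁻¹) ^ 2 := by
  have hk : c.check C.e = true := AtlasCurve.cell_check h hc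
  have h5 := AtlasCell.five_le_of_check hk
  have hordin := AtlasCell.isOrdinaryAt_of_check hk
  have hap := AtlasCell.frobeniusTrace_of_check hk
  obtain ⟨hr, ho, -, -, -⟩ :=
    C.padicRow h hc (Schneider1985_order_charGenerator.of_odd hS) hf hkato hlow D hD hint htab
  have hrank : (C.e.baseChange ℚ).mordellWeilRank = 2 := by rw [AtlasCurve.baseChange_e]; exact hr
  have htab' : ∀ u : ℕ, u < c.p ^ (c.certL.n + 1) → ¬ c.p ∣ u →
      ratPlusSymbol f ((u : ℚ) / (c.p : ℚ) ^ (c.certL.n + 1)) = (c.certL.tabHi.getD u 0 : ℚ) / D ∧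
      ratPlusSymbol f ((u : ℚ) / (c.p : ℚ) ^ c.certL.n) = (c.certL.tabLo.getD u 0 : ℚ) / D :=
    fun u hu' hpu => by
      rw [AtlasCell.certL_tabLo_getD c hu']
      exact htab u hu' hpu
  have hcoeff := norm_coeff_eq_one_of_symbolCertL c.p (C.e.baseChange ℚ) hordin hf hap c.certL
    (AtlasCell.validL_of_check hk) (AtlasCell.unitL_of_unitCheck hu) D hD hint htab'
  have hcoeff' : ‖PowerSeries.coeff (C.e.baseChange ℚ).mordellWeilRank
      (padicLFunction f (unitRoot (C.e.baseChange ℚ) c.p : ℚ_[c.p]))‖ = 1 := by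
    rw [hrank]; exact hcoeff
  have hord : (padicLFunction f (unitRoot (C.e.baseChange ℚ) c.p : ℚ_[c.p])).order =
      (C.e.baseChange ℚ).mordellWeilRank := by rw [hrank]; exact ho
  have hna : ¬ ((c.p : ℤ) ∣ (C.e.baseChange ℚ).frobeniusTrace c.p - 1) := by
    rw [hap]; exact AtlasCell.not_dvd_ap_sub_one_of_unitCheck hu
  obtain ⟨hsha, hreg⟩ := sha_card_eq_one_heightFree hS (C.e.baseChange ℚ) c.p f hkato h5 hordin.1
    hordin.2 hsurj hf hord hcoeff' hna htam hm hadm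
  refine ⟨hr, hsha, fun Dh hDh => ?_⟩
  have := hreg Dh hDh
  rw [hrank] at this
  exact_mod_cast this

/-- **The HEIGHT-FREE row of a unit cell of the RANK-3 atlas** (`AtlasCurve3`, `check3`, `certL3`): same
inputs as `AtlasCurve.heightFreeRow` with `hlow : 3 ≤ rank`; conclusion `rank E(ℚ) = 3`, `#Ш(E/ℚ)[p^∞] = 1`,
`ord_p Reg_p(E, Dh) = 3` for every canonical `Dh`. Per cell; NOT a class theorem.
[cite: Kato2004Asterisque, Thm. 17.4 (3) (p. 273)] [cite: BalakrishnanMullerStein2015, Thm. 1.7]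
[cite: MazurTateTeitelbaum1986Invent, §I.10–I.13] [cite: SteinWuthrich2013, §4.1 and Alg. 11.1] -/
theorem AtlasCurve3.heightFreeRow {C : AtlasCurve3} (h : C.check = true) {c : AtlasCell}
    (hc : c ∈ C.cells) (hu : c.unitCheck = true) [Fact c.p.Prime]
    [(C.e.baseChange ℚ).IsElliptic] [(C.e.baseChange ℚ).IsGloballyMinimal]
    (hS : Schneider1985_order_charGenerator_odd) {N : ℕ} [NeZero N] {f : CuspForm (Gamma0 N) 2}
    (hf : IsNewformOf (C.e.baseChange ℚ) f)
    (hkato : ∀ (κ : ZpExtension ℚ c.p) (γ : Field.absoluteGaloisGroup ℚ),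
      kato_divisibility (C.e.baseChange ℚ) c.p (κ := κ) (γ := γ) (f := f))
    (hlow : 3 ≤ C.row.curve.mordellWeilRank) (D : ℚ) (hD : ‖(D : ℚ_[c.p])‖ = 1)
    (hint : ∀ x : ℚ, ‖(ratPlusSymbol f x : ℚ_[c.p])‖ ≤ 1)
    (htab : ∀ u : ℕ, u < c.p ^ (c.n + 1) → ¬ c.p ∣ u →
      ratPlusSymbol f ((u : ℚ) / (c.p : ℚ) ^ (c.n + 1)) = (c.tabHi.getD u 0 : ℚ) / D ∧
      ratPlusSymbol f ((u : ℚ) / (c.p : ℚ) ^ c.n) = (c.tabLo.getD (u % c.p ^ c.n) 0 : ℚ) / D)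
    (hsurj : Surj (C.e.baseChange ℚ) c.p) (htam : ¬ c.p ∣ (C.e.baseChange ℚ).tamagawaProduct)
    {m : ℕ} (hm : ¬ c.p ∣ m)
    (hadm : ∀ P : (C.e.baseChange ℚ).toAffine.Point, ¬ IsOfFinAddOrder P →
      (C.e.baseChange ℚ).IsAdmissible c.p (m • P)) :
    C.row.curve.mordellWeilRank = 3 ∧
      Nat.card (AddCommGroup.primaryComponent (C.e.baseChange ℚ).sha c.p) = 1 ∧
      ∀ Dh : PAdicHeightData (C.e.baseChange ℚ) c.p, Dh.IsCanonical →
        (padicRegulator Dh).valuation = 3 ∧ ‖padicRegulator Dh‖ = ((c.p : ℝ)⁻¹) ^ 3 := by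
  have hk : c.check3 C.e = true := AtlasCurve3.cell_check h hc
  have h5 := (AtlasCell.arith_of_check3 hk).2.1
  have hordin := AtlasCell.isOrdinaryAt_of_check3 hk
  have hap := AtlasCell.frobeniusTrace_of_check3 hk
  obtain ⟨hr, ho, -, -, -⟩ :=
    C.padicRow h hc (Schneider1985_order_charGenerator.of_odd hS) hf hkato hlow D hD hint htab
  have hbc : C.e.baseChange ℚ = C.row.curve := by
    ext <;> simp [AtlasCurve3.e, Rank3Row.curve, WeierstrassCurve.baseChange]
  have hrank : (C.e.baseChange ℚ).mordellWeilRank = 3 := by rw [hbc]; exact hr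
  have htab' : ∀ u : ℕ, u < c.p ^ (c.certL3.n + 1) → ¬ c.p ∣ u →
      ratPlusSymbol f ((u : ℚ) / (c.p : ℚ) ^ (c.certL3.n + 1)) = (c.certL3.tabHi.getD u 0 : ℚ) / D ∧
      ratPlusSymbol f ((u : ℚ) / (c.p : ℚ) ^ c.certL3.n) = (c.certL3.tabLo.getD u 0 : ℚ) / D :=
    fun u hu' hpu => by
      rw [AtlasCell.certL3_tabLo_getD c hu']
      exact htab u hu' hpu
  have hcoeff := norm_coeff_eq_one_of_symbolCertL c.p (C.e.baseChange ℚ) hordin hf hap c.certL3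
    (AtlasCell.validL_of_check3 hk) (AtlasCell.unitL3_of_unitCheck hu) D hD hint htab'
  have hcoeff' : ‖PowerSeries.coeff (C.e.baseChange ℚ).mordellWeilRank
      (padicLFunction f (unitRoot (C.e.baseChange ℚ) c.p : ℚ_[c.p]))‖ = 1 := by
    rw [hrank]; exact hcoeff
  have hord : (padicLFunction f (unitRoot (C.e.baseChange ℚ) c.p : ℚ_[c.p])).order =
      (C.e.baseChange ℚ).mordellWeilRank := by rw [hrank]; exact ho
  have hna : ¬ ((c.p : ℤ) ∣ (C.e.baseChange ℚ).frobeniusTrace c.p - 1) := by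
    rw [hap]; exact AtlasCell.not_dvd_ap_sub_one_of_unitCheck hu
  obtain ⟨hsha, hreg⟩ := sha_card_eq_one_heightFree hS (C.e.baseChange ℚ) c.p f hkato h5 hordin.1
    hordin.2 hsurj hf hord hcoeff' hna htam hm hadm
  refine ⟨hr, hsha, fun Dh hDh => ?_⟩
  have := hreg Dh hDh
  rw [hrank] at this
  exact_mod_cast this

/-! ## §6. Exemplar: `389a1` — every atlas cell (`p = 5, 7, 11, 13`) is a unit cell -/

/-- **Exemplar (kernel, `decide`)**: all four atlas cells of `389a1` (`p = 5, 7, 11, 13`, file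
`Rank2ObservatoryPadicAtlasR2A00`) pass the unit test: `p ∤ A·H − L` and `p ∤ a_p − 1`. With `∏c_ℓ = 1`,
`E(ℚ)_tors = 0` and `ρ̄_{E,p}` surjective at these `p` (census), `AtlasCurve.heightFreeRow` gives
`Ш(389a1/ℚ)[p^∞] = 0` and `ord_p Reg_p = 2` at `p = 5, 7, 11, 13` under the named facts — the primes of
Stein–Wuthrich's Thm. 12.3, reached there by computing `Reg_p`. [cite: SteinWuthrich2013, Thm. 12.3] -/
theorem unitCheck_c389a1 : (c389a1.cells.all fun c => c.unitCheck) = true := by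
  decide +kernel

/-- The two kernel tests of `389a1` (from the atlas certificate `c389a1_ok`). [folklore] -/
theorem check_c389a1 : c389a1.check = true ∧ c389a1.minCheck = true := by
  simpa only [Bool.and_eq_true] using c389a1_ok

/-- `389a1 ⊗ ℚ` is elliptic (kernel: `Δ ≠ 0`). [folklore] -/
instance isElliptic_c389a1 : (c389a1.e.baseChange ℚ).IsElliptic := AtlasCurve.isElliptic check_c389a1.1

/-- The integer model of `389a1` is globally minimal (kernel: the finite criterion `minCheck`).
[cite: SilvermanAEC2009, VII.1 Remark 1.1] -/
instance isGloballyMinimal_c389a1 : (c389a1.e.baseChange ℚ).IsGloballyMinimal :=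
  AtlasCurve.isGloballyMinimal check_c389a1.2

/-- **`389a1`, height-free row at each atlas prime**: for every cell `c` of `c389a1` (all unit cells,
`unitCheck_c389a1`; the curve's kernel certificate `c389a1_ok` supplies `check`, ellipticity and global
minimality), GIVEN the named facts and the per-curve census inputs of `AtlasCurve.heightFreeRow`:
`rank = 2`, `#Ш[p^∞] = 1`, `ord_p Reg_p = 2`. Per curve; NOT a class theorem.
[cite: SteinWuthrich2013, Thm. 12.3] [cite: Kato2004Asterisque, Thm. 17.4 (3) (p. 273)]
[cite: BalakrishnanMullerStein2015, Thm. 1.7] -/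
theorem heightFreeRow_c389a1 {c : AtlasCell} (hc : c ∈ c389a1.cells) [Fact c.p.Prime]
    (hS : Schneider1985_order_charGenerator_odd) {N : ℕ} [NeZero N] {f : CuspForm (Gamma0 N) 2}
    (hf : IsNewformOf (c389a1.e.baseChange ℚ) f)
    (hkato : ∀ (κ : ZpExtension ℚ c.p) (γ : Field.absoluteGaloisGroup ℚ),
      kato_divisibility (c389a1.e.baseChange ℚ) c.p (κ := κ) (γ := γ) (f := f))
    (hlow : 2 ≤ c389a1.row.curve.mordellWeilRank) (D : ℚ) (hD : ‖(D : ℚ_[c.p])‖ = 1)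
    (hint : ∀ x : ℚ, ‖(ratPlusSymbol f x : ℚ_[c.p])‖ ≤ 1)
    (htab : ∀ u : ℕ, u < c.p ^ (c.n + 1) → ¬ c.p ∣ u →
      ratPlusSymbol f ((u : ℚ) / (c.p : ℚ) ^ (c.n + 1)) = (c.tabHi.getD u 0 : ℚ) / D ∧
      ratPlusSymbol f ((u : ℚ) / (c.p : ℚ) ^ c.n) = (c.tabLo.getD (u % c.p ^ c.n) 0 : ℚ) / D)
    (hsurj : Surj (c389a1.e.baseChange ℚ) c.p) (htam : ¬ c.p ∣ (c389a1.e.baseChange ℚ).tamagawaProduct)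
    {m : ℕ} (hm : ¬ c.p ∣ m)
    (hadm : ∀ P : (c389a1.e.baseChange ℚ).toAffine.Point, ¬ IsOfFinAddOrder P →
      (c389a1.e.baseChange ℚ).IsAdmissible c.p (m • P)) :
    c389a1.row.curve.mordellWeilRank = 2 ∧
      Nat.card (AddCommGroup.primaryComponent (c389a1.e.baseChange ℚ).sha c.p) = 1 ∧
      ∀ Dh : PAdicHeightData (c389a1.e.baseChange ℚ) c.p, Dh.IsCanonical →
        (padicRegulator Dh).valuation = 2 ∧ ‖padicRegulator Dh‖ = ((c.p : ℝ)⁻¹) ^ 2 := by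
  have hu : c.unitCheck = true := List.all_eq_true.mp unitCheck_c389a1 c hc
  exact AtlasCurve.heightFreeRow check_c389a1.1 hc hu hS hf hkato hlow D hD hint htab hsurj htam hm hadm

end Summit.BirchSwinnertonDyer.BirchSwinnertonDyer.Rank2Observatory

end
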